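import Mathlib
import HarnessLib
import Summits.ResolutionOfSingularities.ResolutionOfSingularities.Theorems.WildQuotientsWildQuotientResolutionS1aKillGlue

/-!
# S1a — `KillableAt` IS CHART-LOCAL DATA: principal-centre chart DATA on a stable affine open (no filtration given) produce a Rees filtration with that chart

[OURS · L1 W4.5c · lead-1 g9; plan-1 g12 RULING 10:56:19Z priority (d), first half: the generic PRODUCER of the killability clause] — NOT statements of
the manuscript; counted 0; AI-level work, weaker than expert review. Crux stmt-ResolutionOfSingularities-17941, line `s1a-logminvertex` v10; serves the
killability clause of `AuxChartsAt` / `AuxOrbitAt` / `AuxTopAt` (`M'.KillableAt v'` over the support). Route-independent.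

`KillableAt M v := ∃ 𝒦 d O, 0 < d ∧ v ∈ O ∧ IsPrincipalCentreChart p M.act g₀ 𝒦 d O` asks for a GLOBAL Rees filtration `𝒦` on `M.V`, but
`IsPrincipalCentreChart` constrains `𝒦` only through its ideals on the one chart `O` (`𝒦.filtration O = (trace of the weighted centre) ∘ e`). This file
removes the global object from the hypothesis: the CHART DATA alone (node `(B, 𝒜, σ, e)` + centre `(f, δ, w)` + Veronese degree + the kill clause — what a
census certificate exhibits) produce the filtration.
* `IdealFiltration.comap` / `IdealFiltration.map` — transport of ideal filtrations along ring homomorphisms;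
* `ReesFiltration.ofTop K` — the Rees filtration `n ↦ ofIdealTop (K n)` of a scheme from an ideal filtration of its global sections;
* `chartFiltration O K` := `pushforwardRees (ReesFiltration.ofTop (K.map (O.ι.appLE O ⊤))) O.ι` — the Rees filtration on `V` GENERATED by an ideal
  filtration `K` of `Γ(V, O)`; ★ `filtration_chartFiltration` — on the chart `O` it IS `K`;
* `NodeAtlas.IsPrincipalChartData p ρ g₀ d O` — the body of `IsPrincipalCentreChart` WITHOUT the filtration (the ∃-bound node and centre data with the kill clause);
* ★★ `exists_isPrincipalCentreChart_of_data` — chart data ⇒ `∃ 𝒦, IsPrincipalCentreChart p ρ g₀ 𝒦 d O`; ★★ `GameFrame.GModel.killableAt_of_chartData` —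
  on a model, every point of a stable affine open carrying principal chart data is KILLABLE.
So a second-level kill certificate on a chart of the weighted blow-up discharges the killability clause there once the chart is known to be a node chart
with the certified node ring (the node-ring exposure of `exists_isNodeChart_of_isCentreChart`, `…S1aBlowupNodeAtlas`).
-/

set_option linter.dupNamespace false

noncomputable section

universe u v

open CategoryTheory Limits AlgebraicGeometry TopologicalSpace Topology Opposite
open Literature.AlgebraicGeometry.Resolution Literature.AlgebraicGeometry.RelativeSpec
open Summit.ResolutionOfSingularities.ResolutionOfSingularities.Theorems.WildQuotientResolution.S1
open Summit.ResolutionOfSingularities.ResolutionOfSingularities.Theorems.WildQuotientResolution.S1.NodeAtlas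
open Summit.ResolutionOfSingularities.ResolutionOfSingularities.Theorems.WildQuotientResolution.S1.ProducerStep
open Summit.ResolutionOfSingularities.ResolutionOfSingularities.Theorems.WildQuotientResolution.S1.CoarseChart
open Summit.ResolutionOfSingularities.ResolutionOfSingularities.Theorems.WildQuotientResolution.S1.KillableTransport
open Summit.ResolutionOfSingularities.ResolutionOfSingularities.Theorems.WildQuotientResolution.S1.ExtendRees
open Summit.ResolutionOfSingularities.ResolutionOfSingularities.Theorems.WildQuotientResolution.S1.ChartStable

/-! ## Transport of ideal filtrations -/

namespace Literature.AlgebraicGeometry.Resolution.IdealFiltration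

variable {A B : Type u} [CommRing A] [CommRing B]

/-- Pull an ideal filtration back along a ring homomorphism. [OURS · L1 W4.5c] -/
def comap (F : IdealFiltration B) (φ : A →+* B) : IdealFiltration A where
  ideal n := (F.ideal n).comap φ
  ideal_zero := by rw [F.ideal_zero, Ideal.comap_top]
  antitone m n h := Ideal.comap_mono (F.antitone h)
  mul_le m n := le_trans (Ideal.le_comap_mul φ) (Ideal.comap_mono (F.mul_le m n))

/-- Push an ideal filtration forward along a ring homomorphism (extension of ideals). [OURS · L1 W4.5c] -/
def map (F : IdealFiltration A) (φ : A →+* B) : IdealFiltration B where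
  ideal n := (F.ideal n).map φ
  ideal_zero := by rw [F.ideal_zero, Ideal.map_top]
  antitone m n h := Ideal.map_mono (F.antitone h)
  mul_le m n := by rw [← Ideal.map_mul]; exact Ideal.map_mono (F.mul_le m n)

/-- Pieces of the pulled-back filtration. -/
@[simp] theorem comap_ideal (F : IdealFiltration B) (φ : A →+* B) (n : ℕ) : (F.comap φ).ideal n = (F.ideal n).comap φ := rfl

/-- Pieces of the pushed-forward filtration. -/
@[simp] theorem map_ideal (F : IdealFiltration A) (φ : A →+* B) (n : ℕ) : (F.map φ).ideal n = (F.ideal n).map φ := rfl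

end Literature.AlgebraicGeometry.Resolution.IdealFiltration

namespace Summit.ResolutionOfSingularities.ResolutionOfSingularities.Theorems.WildQuotientResolution.S1.ChartData

/-! ## A Rees filtration from an ideal filtration of the global sections -/

section OfTop

variable {X : Scheme.{u}}

/-- **`ReesFiltration.ofTop K`**: the Rees filtration `n ↦ ofIdealTop (K n)` (Mathlib: the ideal sheaf generated by an ideal of global sections).
[OURS · L1 W4.5c] -/
def ofTop (K : IdealFiltration Γ(X, ⊤)) : ReesFiltration X where
  ideal n := Scheme.IdealSheafData.ofIdealTop (K.ideal n)
  ideal_zero := by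
    apply Scheme.IdealSheafData.ext
    funext U
    rw [Scheme.IdealSheafData.ofIdealTop_ideal, K.ideal_zero, Ideal.map_top]
    rfl
  antitone m n h U := by
    change (Scheme.IdealSheafData.ofIdealTop (K.ideal n)).ideal U ≤ (Scheme.IdealSheafData.ofIdealTop (K.ideal m)).ideal U
    rw [Scheme.IdealSheafData.ofIdealTop_ideal, Scheme.IdealSheafData.ofIdealTop_ideal]
    exact Ideal.map_mono (K.antitone h)
  mul_le m n U := by
    change (Scheme.IdealSheafData.ofIdealTop (K.ideal m) * Scheme.IdealSheafData.ofIdealTop (K.ideal n)).ideal U ≤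
      (Scheme.IdealSheafData.ofIdealTop (K.ideal (m + n))).ideal U
    rw [Scheme.IdealSheafData.ideal_mul, Pi.mul_apply, Scheme.IdealSheafData.ofIdealTop_ideal, Scheme.IdealSheafData.ofIdealTop_ideal,
      Scheme.IdealSheafData.ofIdealTop_ideal, ← Ideal.map_mul]
    exact Ideal.map_mono (K.mul_le m n)

/-- Pieces of `ofTop` on an affine open: the extension of `K n` along the restriction map. -/
theorem ofTop_ideal_ideal (K : IdealFiltration Γ(X, ⊤)) (n : ℕ) (U : X.affineOpens) :
    ((ofTop K).ideal n).ideal U = (K.ideal n).map (X.presheaf.map (homOfLE le_top).op).hom := by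
  change (Scheme.IdealSheafData.ofIdealTop (K.ideal n)).ideal U = _
  rw [Scheme.IdealSheafData.ofIdealTop_ideal]

end OfTop

/-! ## The Rees filtration on `V` generated by an ideal filtration of `Γ(V, O)` -/

section Chart

variable {V : Scheme.{u}} [IsLocallyNoetherian V]

/-- **`chartFiltration O K`** — push the ideal filtration `K` of `Γ(V, O)` to `Γ(↑O, ⊤)`, take the generated Rees filtration on `↑O`, and extend it by
the unit filtration along `O.ι`. [OURS · L1 W4.5c] -/
def chartFiltration (O : V.Opens) (K : IdealFiltration Γ(V, O)) : ReesFiltration V :=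
  pushforwardRees (ofTop (K.map (O.ι.appLE O ⊤ O.ι_preimage_self.ge).hom)) O.ι

/-- ★ **On the chart `O`, the generated filtration IS `K`.** [OURS · L1 W4.5c] -/
theorem filtration_chartFiltration (O : V.Opens) (hO : IsAffineOpen O) (K : IdealFiltration Γ(V, O)) (n : ℕ) :
    ((chartFiltration O K).filtration ⟨O, hO⟩).ideal n = K.ideal n := by
  haveI : IsAffine (O : Scheme.{u}) := hO
  have H : IsAffineOpen (O.ι ⁻¹ᵁ O) := by rw [Scheme.Opens.ι_preimage_self]; exact isAffineOpen_top _
  rw [ReesFiltration.filtration_ideal, chartFiltration, pushforwardRees_ideal,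
    Scheme.IdealSheafData.ideal_map _ O.ι ⟨O, hO⟩ H, ofTop_ideal_ideal, IdealFiltration.map_ideal, Ideal.map_map,
    ← CommRingCat.hom_comp, Scheme.Hom.appLE_map, ← Scheme.Hom.app_eq_appLE]
  -- `O.ι.app O` is an isomorphism
  haveI : IsIso (O.ι.appLE O (O.ι ⁻¹ᵁ O) le_rfl) := isIso_ι_appLE O
  have hbij : Function.Bijective (O.ι.app O).hom := by
    rw [Scheme.Hom.app_eq_appLE]
    exact (asIso (O.ι.appLE O (O.ι ⁻¹ᵁ O) le_rfl)).commRingCatIsoToRingEquiv.bijective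
  exact Ideal.comap_map_of_bijective _ hbij

end Chart

end Summit.ResolutionOfSingularities.ResolutionOfSingularities.Theorems.WildQuotientResolution.S1.ChartData

/-! ## Principal chart DATA and the producer -/

namespace Summit.ResolutionOfSingularities.ResolutionOfSingularities.Theorems.WildQuotientResolution.S1.NodeAtlas

open ChartData

variable (p : ℕ) {V Y : Scheme.{u}} {q : V ⟶ Y} {G : Type*} [Group G] (ρ : ActionOver q G) (g₀ : G)

/-- **PRINCIPAL CHART DATA** on a stable affine open `O` with Veronese degree `d`: the body of `IsPrincipalCentreChart` with the Rees filtration REMOVED —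
a tame node `(B, 𝒜, σ)` presenting `Γ(V, O)` by `e` with the intertwining of `g₀`, a K1′-regular σ-adapted homogeneous weighted centre `(f, δ, w)`, `d` a
Veronese degree of its degree-0 trace, and the KILL clause (principal augmentation ideal on every invariant chart of the weighted blow-up). This is what a
kill certificate exhibits. [OURS · L1 W4.5c] -/
def IsPrincipalChartData (d : ℕ) (O : ρ.StableAffineOpens) : Prop :=
  ∃ (_ : IsAffineOpen O.1) (m : ℕ) (r : Fin m → ℕ) (B : Type u) (_ : CommRing B)
    (𝒜 : (Π j : Fin m, ZMod (r j)) → AddSubgroup B) (_ : GradedRing 𝒜) (σ : B ≃+* B)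
    (e : Γ(V, O.1) ≃+* ↥(𝒜 0)),
    IsTameNode p B 𝒜 σ ∧
    (∀ t : Γ(V, O.1),
      ((e ((ρ.aut g₀⁻¹).hom.appLE O.1 O.1 (O.2.1 g₀⁻¹).ge t) : ↥(𝒜 0)) : B) = σ ((e t : ↥(𝒜 0)) : B)) ∧
    ∃ (c : ℕ) (f : Fin c → B) (δ : Fin c → Π j : Fin m, ZMod (r j)) (w : Fin c → ℕ),
      0 < c ∧ (∀ i, f i ∈ 𝒜 (δ i)) ∧ (∀ i, 0 < w i) ∧
      RingTheory.Sequence.IsRegular B (List.ofFn f) ∧ IsRegularRing (B ⧸ Ideal.span (Set.range f)) ∧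
      ∃ (hσJ : ∀ n : ℕ, ((weightedFiltration f w).ideal n).map (σ : B →+* B) ≤ (weightedFiltration f w).ideal n),
      CoarseChart.VeroneseNormalised 𝒜 f w d ∧
      ∀ (hp : 0 < p) (hσp : ∀ x : B, (⇑σ)^[p] x = x) (d' : ℕ) (b : ↥(𝒜 0))
        (hb : b ∈ (CoarseChart.traceFiltration 𝒜 f w).ideal d') (hσb : σ (b : B) = b), 0 < d' →
        (augmentationIdeal (CoarseChart.sigmaChart 𝒜 f w d' b hb σ hσJ hp hσp hσb)).IsPrincipal

variable {p ρ g₀}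

/-- A principal-centre chart carries principal chart data (forget the filtration). -/
theorem isPrincipalChartData_of_isPrincipalCentreChart {𝒦 : ReesFiltration V} {d : ℕ} {O : ρ.StableAffineOpens}
    (h : IsPrincipalCentreChart p ρ g₀ 𝒦 d O) : IsPrincipalChartData p ρ g₀ d O := by
  obtain ⟨hO, m, r, B, _, 𝒜, _, σ, e, hnode, hσ, c, f, δ, w, hc, hf, hw, hK1, hK1', hσJ, -, hver, hprin⟩ := h
  exact ⟨hO, m, r, B, inferInstance, 𝒜, inferInstance, σ, e, hnode, hσ, c, f, δ, w, hc, hf, hw, hK1, hK1', hσJ, hver, hprin⟩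

/-- ★★ **THE PRODUCER: principal chart DATA give a Rees filtration for which the chart IS a principal-centre chart** (`V` locally Noetherian): the
filtration is `chartFiltration O ((traceFiltration 𝒜 f w).comap e)`. [OURS · L1 W4.5c] -/
theorem exists_isPrincipalCentreChart_of_data [IsLocallyNoetherian V] {d : ℕ} {O : ρ.StableAffineOpens} (h : IsPrincipalChartData p ρ g₀ d O) :
    ∃ 𝒦 : ReesFiltration V, IsPrincipalCentreChart p ρ g₀ 𝒦 d O := by
  obtain ⟨hO, m, r, B, _, 𝒜, _, σ, e, hnode, hσ, c, f, δ, w, hc, hf, hw, hK1, hK1', hσJ, hver, hprin⟩ := h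
  let K : IdealFiltration Γ(V, O.1) := (CoarseChart.traceFiltration 𝒜 f w).comap (e : Γ(V, O.1) →+* ↥(𝒜 0))
  refine ⟨chartFiltration O.1 K, hO, m, r, B, inferInstance, 𝒜, inferInstance, σ, e, hnode, hσ, c, f, δ, w, hc, hf, hw, hK1, hK1', hσJ,
    fun n => ?_, hver, hprin⟩
  rw [filtration_chartFiltration O.1 hO K n]
  rfl

/-- The degree of principal chart data is positive (it is a Veronese degree). -/
theorem IsPrincipalChartData.pos {d : ℕ} {O : ρ.StableAffineOpens} (h : IsPrincipalChartData p ρ g₀ d O) : 0 < d := by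
  obtain ⟨_, m, r, B, _, 𝒜, _, σ, e, _, _, c, f, δ, w, _, _, _, _, _, _, hver, _⟩ := h
  exact hver.1

end Summit.ResolutionOfSingularities.ResolutionOfSingularities.Theorems.WildQuotientResolution.S1.NodeAtlas

/-! ## On a model: every point of a chart with principal data is killable -/

namespace Summit.ResolutionOfSingularities.ResolutionOfSingularities.Theorems.WildQuotientResolution.S1.GameFrame.GModel

variable {p : ℕ} {X' X₁ : Scheme.{0}} {q : X' ⟶ X₁} {G : Type} [Group G] {ρ : G →* Aut X'} {g₀ : G}

/-- ★★ **PRINCIPAL CHART DATA KILL**: on a model, every point of a stable affine open carrying principal chart data is `KillableAt`. This is the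
formal consumer of a second-level kill certificate. [OURS · L1 W4.5c] -/
theorem killableAt_of_chartData (M : GModel p q G ρ g₀) {d : ℕ} {O : M.act.StableAffineOpens}
    (h : NodeAtlas.IsPrincipalChartData p M.act g₀ d O) {v : M.V} (hv : v ∈ O.1) : M.KillableAt v := by
  haveI : IsLocallyNoetherian M.V := M.isLocallyNoetherian
  obtain ⟨𝒦, h𝒦⟩ := NodeAtlas.exists_isPrincipalCentreChart_of_data h
  exact ⟨𝒦, d, O, h.pos, hv, h𝒦⟩

/-- Hence a chart with principal data contains no non-killable point, and its BAD points lie in `Z(M) ∖ nonKillable`. -/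
theorem disjoint_nonKillable_of_chartData (M : GModel p q G ρ g₀) {d : ℕ} {O : M.act.StableAffineOpens}
    (h : NodeAtlas.IsPrincipalChartData p M.act g₀ d O) : Disjoint (O.1 : Set M.V) M.nonKillable :=
  Set.disjoint_left.mpr fun _ hv hn => hn.2 (M.killableAt_of_chartData h hv)

end Summit.ResolutionOfSingularities.ResolutionOfSingularities.Theorems.WildQuotientResolution.S1.GameFrame.GModel

end
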